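import Mathlib
import Summits.Ventures.PercRepro2.Defs
import Summits.Ventures.PercRepro2.Independence
import Summits.Ventures.PercRepro2.Harris
import Summits.Ventures.PercRepro2.Graph
import Summits.Ventures.PercRepro2.Events
import Summits.Ventures.PercRepro2.Induced
import Summits.Ventures.PercRepro2.SameClusterAvoid
import Summits.Ventures.PercRepro2.OrderPreservation
import Summits.Ventures.PercRepro2.BHKMixed

/-!
# The exploration record `T`, the pinned law `p_T`, stopping rules and the disintegration
(blind cell PercRepro2, typer-1 g9; ASSIGNMENTS v12.49 «the exploration record T and P(x ∈ C₂ | T) as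
typed objects»; lead g24 mining/lead/g24/README «PATHMIX», «LEAN SHAPE OF THE GIVEN-T BHK PART»)

* `Record E` — an exploration record: the explored OPEN edges `op` and the explored CLOSED edges `cl`
  (disjoint finsets).  `T.cyl` is the cylinder event `{ω : ω = 1 on op, ω = 0 on cl}`;
  `T.weights p = p_T` is the pinned weight vector (`1` on `op`, `0` on `cl`, `p` elsewhere — the
  product law of the unexamined edges with the explored edges forced); `T.mass p = ∏_{op} p_e · ∏_{cl} (1 − p_e)`
  is `P(cyl T)`.
* **Disintegration** (`weight_mul_indicator_cyl`, pointwise): `weight p ω · 1_{cyl T}(ω) = mass T · weight p_T ω`;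
  hence `E_p[f · 1_{cyl T}] = P(cyl T) · E_{p_T}[f]` (`expect_mul_indicator_cyl`),
  `P(A ∩ cyl T) = P(cyl T) · P_{p_T}(A)` (`prob_inter_cyl`), `P(cyl T) = mass T` (`prob_cyl`):
  «given the record, the rest is the product law `p_T`» — the spatial Markov property in the form the
  PATHMIX decomposition uses.  `p_T` is admissible (`isProbVec_weights`).
* `StoppingRule E` — a rule `record : Config E → Record E` that reads only the edges it has explored:
  `consistent` (`ω ∈ (record ω).cyl`) and `stopping` (two configurations agreeing on the explored edges
  of `ω` have the same record).  Then the FIBRE `{record = T}` of a record in the range is exactly the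
  cylinder (`record_eq_iff_mem_cyl`, `fibre_eq_cyl`), and the **law of total expectation over the records**
  `E_p[f] = Σ_{T ∈ records} P(cyl T) · E_{p_T}[f]` (`expect_eq_sum_records`) is the disintegration
  `P¹(·) = Σ_T P(T) · P_{p_T}(·)` of the lead's line.  The BFS-from-`a₁`-until-`a₃` exploration is ONE
  stopping rule (its construction is a separate file); every statement here holds for every rule.
* The conditional quantities given `T` are probabilities under `p_T`: `condQ p T A = P_{p_T}(Q ∩ A)`
  (`Q = {a₁ ↮ a₂}`), i.e. `P(x ∈ C₂ | T, Q)` cleared by `P_{p_T}(Q)`; **the given-`T` BHK part is one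
  instance of the tree's BHK 1.3 at `p_T`**: `cov_given_T_nonneg` —
  `P_{p_T}(Q, b ∈ C₂) · P_{p_T}(Q, o ∈ C₂) ≤ P_{p_T}(Q, b ∈ C₂, o ∈ C₂) · P_{p_T}(Q)` for every record `T`
  (`bhk_same_cluster_events_avoid (T.weights p)`), and its (i)-side twin is the cross-cluster BHK 1.4
  at `p_T`.  No PATHMIX inequality is claimed; only the objects and the exact identities.
-/

namespace Summit.Ventures.PercRepro2

namespace Explore

/-! ## Records and cylinders -/

section Record

variable {E : Type*} [DecidableEq E]

/-- An exploration record: the explored open edges `op` and the explored closed edges `cl`. -/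
@[ext]
structure Record (E : Type*) where
  /-- explored edges found open -/
  op : Finset E
  /-- explored edges found closed -/
  cl : Finset E
  /-- an edge is found either open or closed -/
  disj : Disjoint op cl

/-- Records are decidable-equal (they are pairs of finsets). -/
instance : DecidableEq (Record E) := fun T T' =>
  decidable_of_iff (T.op = T'.op ∧ T.cl = T'.cl) ⟨fun ⟨h1, h2⟩ => Record.ext h1 h2, fun h => ⟨by rw [h], by rw [h]⟩⟩

/-- The explored edges of a record. -/
def Record.explored (T : Record E) : Finset E := T.op ∪ T.cl

/-- The cylinder event of a record: the configurations that show the record's edge states. -/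
def Record.cyl (T : Record E) : Set (Config E) :=
  {ω | (∀ e ∈ T.op, ω e = true) ∧ ∀ e ∈ T.cl, ω e = false}

omit [DecidableEq E] in
/-- Membership in the cylinder. -/
lemma Record.mem_cyl {T : Record E} {ω : Config E} :
    ω ∈ T.cyl ↔ (∀ e ∈ T.op, ω e = true) ∧ ∀ e ∈ T.cl, ω e = false := Iff.rfl

/-- Two configurations in the same cylinder agree on the explored edges. -/
lemma Record.agree_of_mem_cyl {T : Record E} {ω ω' : Config E} (h : ω ∈ T.cyl) (h' : ω' ∈ T.cyl) :
    ∀ e ∈ T.explored, ω' e = ω e := by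
  intro e he
  rcases Finset.mem_union.1 he with ho | hc
  · rw [h.1 e ho, h'.1 e ho]
  · rw [h.2 e hc, h'.2 e hc]

variable {R : Type*} [CommRing R]

/-- The pinned weight vector `p_T`: `1` on the explored open edges, `0` on the explored closed edges,
`p` on the unexamined edges — the law of the configuration given the record. -/
def Record.weights (T : Record E) (p : E → R) : E → R :=
  fun e => if e ∈ T.op then 1 else if e ∈ T.cl then 0 else p e

/-- The Bernoulli factor of one edge carried by the record:
`p e` on `op`, `1 − p e` on `cl`, `1` elsewhere. -/
def Record.factor (T : Record E) (p : E → R) (e : E) : R :=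
  if e ∈ T.op then p e else if e ∈ T.cl then 1 - p e else 1

/-- The mass of the record: `∏_e factor = ∏_{op} p_e · ∏_{cl} (1 − p_e)` (`= P(cyl T)`, `prob_cyl`). -/
def Record.mass [Fintype E] (T : Record E) (p : E → R) : R := ∏ e, T.factor p e

/-- `mass = ∏_{op} p_e · ∏_{cl} (1 − p_e)`. -/
lemma Record.mass_eq [Fintype E] (T : Record E) (p : E → R) :
    T.mass p = (∏ e ∈ T.op, p e) * ∏ e ∈ T.cl, (1 - p e) := by
  unfold Record.mass Record.factor
  rw [Finset.prod_ite, Finset.prod_ite]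
  have h1 : Finset.univ.filter (fun e => e ∈ T.op) = T.op := by ext e; simp
  have h2 : (Finset.univ.filter (fun e => e ∉ T.op)).filter (fun e => e ∈ T.cl) = T.cl := by
    ext e
    simp only [Finset.mem_filter, Finset.mem_univ, true_and, and_iff_right_iff_imp]
    exact fun he => Finset.disjoint_right.1 T.disj he
  rw [h1, h2, Finset.prod_const_one, mul_one]

end Record

/-! ## The disintegration: given the record, the rest is the product law `p_T` -/

section Disintegration

variable {E : Type*} [Fintype E] [DecidableEq E] {R : Type*} [CommRing R]

/-- **The pointwise disintegration**: `weight p ω · 1_{cyl T}(ω) = mass T · weight p_T ω`.  On the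
cylinder every explored factor of `weight p` is `p_e` or `1 − p_e` and the pinned factor is `1`; off the
cylinder some pinned factor vanishes. -/
theorem weight_mul_indicator_cyl (T : Record E) (p : E → R) (ω : Config E) :
    weight p ω * (T.cyl).indicator 1 ω = T.mass p * weight (T.weights p) ω := by
  by_cases h : ω ∈ T.cyl
  · rw [Set.indicator_of_mem h, Pi.one_apply, mul_one]
    unfold weight Record.mass
    rw [← Finset.prod_mul_distrib]
    refine Finset.prod_congr rfl fun e _ => ?_
    unfold Record.factor Record.weights
    by_cases ho : e ∈ T.op
    · have hω : ω e = true := h.1 e ho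
      simp [ho, hω]
    · by_cases hc : e ∈ T.cl
      · have hω : ω e = false := h.2 e hc
        simp [ho, hc, hω]
      · simp [ho, hc]
  · rw [Set.indicator_of_notMem h, mul_zero]
    symm
    apply mul_eq_zero_of_right
    unfold weight
    by_cases hA : ∀ e ∈ T.op, ω e = true
    · have hB : ∃ e ∈ T.cl, ω e = true := by
        by_contra hcon
        refine h ⟨hA, fun e he => ?_⟩
        cases hω : ω e
        · rfl
        · exact absurd ⟨e, he, hω⟩ hcon
      obtain ⟨e, he, hω⟩ := hB
      refine Finset.prod_eq_zero (Finset.mem_univ e) ?_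
      have ho : e ∉ T.op := Finset.disjoint_right.1 T.disj he
      simp [Record.weights, ho, he, hω]
    · have hA' : ∃ e ∈ T.op, ω e = false := by
        by_contra hcon
        refine hA fun e he => ?_
        cases hω : ω e
        · exact absurd ⟨e, he, hω⟩ hcon
        · rfl
      obtain ⟨e, he, hω⟩ := hA'
      refine Finset.prod_eq_zero (Finset.mem_univ e) ?_
      simp [Record.weights, he, hω]

/-- **Disintegration for observables**: `E_p[f · 1_{cyl T}] = mass T · E_{p_T}[f]`. -/
theorem expect_mul_indicator_cyl (T : Record E) (p : E → R) (f : Config E → R) :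
    expect p (fun ω => f ω * (T.cyl).indicator 1 ω) = T.mass p * expect (T.weights p) f := by
  unfold expect
  rw [Finset.mul_sum]
  refine Finset.sum_congr rfl fun ω _ => ?_
  have := weight_mul_indicator_cyl T p ω
  calc weight p ω * (f ω * (T.cyl).indicator 1 ω)
      = (weight p ω * (T.cyl).indicator 1 ω) * f ω := by ring
    _ = T.mass p * weight (T.weights p) ω * f ω := by rw [this]
    _ = T.mass p * (weight (T.weights p) ω * f ω) := by ring

/-- `P(cyl T) = mass T`. -/
theorem prob_cyl (T : Record E) (p : E → R) : prob p T.cyl = T.mass p := by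
  rw [prob_eq_expect_indicator]
  have := expect_mul_indicator_cyl T p (fun _ => 1)
  simp only [one_mul] at this
  rw [this]
  simp

/-- **Disintegration for events**: `P(A ∩ cyl T) = P(cyl T) · P_{p_T}(A)` — given the record, `A` has its
probability under the pinned law. -/
theorem prob_inter_cyl (T : Record E) (p : E → R) (A : Set (Config E)) :
    prob p (A ∩ T.cyl) = T.mass p * prob (T.weights p) A := by
  rw [prob_eq_expect_indicator, prob_eq_expect_indicator, ← expect_mul_indicator_cyl]
  congr 1
  funext ω
  by_cases hA : ω ∈ A <;> by_cases hT : ω ∈ T.cyl <;> simp [hA, hT]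

end Disintegration

section Admissible

variable {E : Type*} [Fintype E] [DecidableEq E] {R : Type*} [CommRing R] [PartialOrder R]
  [IsOrderedRing R]

omit [Fintype E] in
/-- The pinned weights are admissible. -/
lemma isProbVec_weights (T : Record E) {p : E → R} (hp : IsProbVec p) : IsProbVec (T.weights p) where
  nonneg e := by
    unfold Record.weights
    split_ifs
    · exact zero_le_one
    · exact le_rfl
    · exact hp.nonneg e
  le_one e := by
    unfold Record.weights
    split_ifs
    · exact le_rfl
    · exact zero_le_one
    · exact hp.le_one e

/-- `0 ≤ mass T`. -/
lemma mass_nonneg (T : Record E) {p : E → R} (hp : IsProbVec p) : 0 ≤ T.mass p := by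
  rw [← prob_cyl]
  exact prob_nonneg hp _

end Admissible

/-! ## Stopping rules and the law of total expectation over the records -/

section Rule

variable {E : Type*} [Fintype E] [DecidableEq E]

/-- A stopping rule: an exploration `rec` that reads only the edges it has explored — the record of `ω`
shows `ω`'s own states (`consistent`), and any configuration agreeing with `ω` on the explored edges of
`ω` gets the same record (`stopping`).  A deterministic edge-order BFS from a root, halted by any
condition on what has been seen, is such a rule. -/
structure StoppingRule (E : Type*) [DecidableEq E] where
  /-- the record revealed by exploring `ω` -/
  record : Config E → Record E
  /-- the record shows the states of its own edges -/
  consistent : ∀ ω, ω ∈ (record ω).cyl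
  /-- the record depends only on the explored edges -/
  stopping : ∀ ω ω', (∀ e ∈ (record ω).explored, ω' e = ω e) → record ω' = record ω

omit [Fintype E] in
/-- The fibre of a record is its cylinder: `record ω' = record ω ↔ ω' ∈ (record ω).cyl`. -/
theorem StoppingRule.record_eq_iff_mem_cyl (rule : StoppingRule E) (ω ω' : Config E) :
    rule.record ω' = rule.record ω ↔ ω' ∈ (rule.record ω).cyl := by
  constructor
  · intro h
    rw [← h]
    exact rule.consistent ω'
  · intro h
    exact rule.stopping ω ω' (Record.agree_of_mem_cyl (rule.consistent ω) h)

omit [Fintype E] in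
/-- For a record in the range of the rule, `{record = T} = cyl T`. -/
theorem StoppingRule.fibre_eq_cyl (rule : StoppingRule E) {T : Record E} {ω₀ : Config E}
    (h₀ : rule.record ω₀ = T) : {ω | rule.record ω = T} = T.cyl := by
  ext ω
  simp only [Set.mem_setOf_eq]
  rw [← h₀]
  exact rule.record_eq_iff_mem_cyl ω₀ ω

/-- The finite set of records a rule can produce. -/
def StoppingRule.records (rule : StoppingRule E) : Finset (Record E) :=
  Finset.univ.image rule.record

/-- Every configuration's record is in `records`. -/
lemma StoppingRule.record_mem_records (rule : StoppingRule E) (ω : Config E) :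
    rule.record ω ∈ rule.records :=
  Finset.mem_image_of_mem _ (Finset.mem_univ ω)

variable {R : Type*} [CommRing R]

/-- **Law of total expectation over the records**: `E_p[f] = Σ_{T ∈ records} P(cyl T) · E_{p_T}[f]` — the
disintegration `P(·) = Σ_T P(T) · P_{p_T}(·)` of the lead's PATHMIX line, for every stopping rule. -/
theorem StoppingRule.expect_eq_sum_records (rule : StoppingRule E) (p : E → R) (f : Config E → R) :
    expect p f = ∑ T ∈ rule.records, T.mass p * expect (T.weights p) f := by
  have step : ∀ ω : Config E, weight p ω * f ω =
      ∑ T ∈ rule.records, (if rule.record ω = T then weight p ω * f ω else 0) := by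
    intro ω
    rw [Finset.sum_ite_eq]
    simp [rule.record_mem_records ω]
  have fib : ∀ T ∈ rule.records, ∀ ω : Config E,
      (if rule.record ω = T then weight p ω * f ω else 0) = f ω * (T.cyl).indicator 1 ω * weight p ω := by
    intro T hT ω
    obtain ⟨ω₀, _, h₀⟩ := Finset.mem_image.1 hT
    have key : rule.record ω = T ↔ ω ∈ T.cyl := by
      rw [← h₀]
      exact rule.record_eq_iff_mem_cyl ω₀ ω
    by_cases h : ω ∈ T.cyl
    · rw [if_pos (key.2 h), Set.indicator_of_mem h]; simp only [Pi.one_apply]; ring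
    · rw [if_neg (fun h' => h (key.1 h')), Set.indicator_of_notMem h]; simp
  calc expect p f = ∑ ω, weight p ω * f ω := rfl
    _ = ∑ ω, ∑ T ∈ rule.records, (if rule.record ω = T then weight p ω * f ω else 0) :=
        Finset.sum_congr rfl fun ω _ => step ω
    _ = ∑ T ∈ rule.records, ∑ ω, (if rule.record ω = T then weight p ω * f ω else 0) := Finset.sum_comm
    _ = ∑ T ∈ rule.records, ∑ ω, f ω * (T.cyl).indicator 1 ω * weight p ω :=
        Finset.sum_congr rfl fun T hT => Finset.sum_congr rfl fun ω _ => fib T hT ω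
    _ = ∑ T ∈ rule.records, expect p (fun ω => f ω * (T.cyl).indicator 1 ω) := by
        refine Finset.sum_congr rfl fun T _ => ?_
        unfold expect
        exact Finset.sum_congr rfl fun ω _ => by ring
    _ = ∑ T ∈ rule.records, T.mass p * expect (T.weights p) f :=
        Finset.sum_congr rfl fun T _ => expect_mul_indicator_cyl T p f

/-- **Law of total probability over the records**: `P(A) = Σ_{T ∈ records} P(cyl T) · P_{p_T}(A)`. -/
theorem StoppingRule.prob_eq_sum_records (rule : StoppingRule E) (p : E → R) (A : Set (Config E)) :
    prob p A = ∑ T ∈ rule.records, T.mass p * prob (T.weights p) A := by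
  rw [prob_eq_expect_indicator, rule.expect_eq_sum_records]
  refine Finset.sum_congr rfl fun T _ => ?_
  rw [prob_eq_expect_indicator]

end Rule

/-! ## The conditional quantities given the record and the given-`T` BHK part -/

section GivenT

variable {V : Type*} {E : Type*} [Fintype E] [DecidableEq E] [Fintype V] [DecidableEq V]
  {R : Type*} [Field R] [LinearOrder R] [IsStrictOrderedRing R]

/-- `P(A, Q | T)` cleared: the probability of `Q ∩ A` under the pinned law `p_T`, `Q = {a₁ ↮ a₂}`
(`avoidAll ends a₂ {a₁}`).  `P(x ∈ C₂ | T, Q) = condQ p T (connEvent ends a₂ x) / condQ p T univ`. -/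
noncomputable def condQ (p : E → R) (ends : E → Sym2 V) (a₁ a₂ : V) (T : Record E)
    (A : Set (Config E)) : R :=
  prob (T.weights p) (avoidAll ends a₂ {a₁} ∩ A)

omit [Fintype V] [DecidableEq V] [LinearOrder R] [IsStrictOrderedRing R] in
/-- The case-1 masses disintegrate over the records: `P(Q ∩ A) = Σ_T mass T · condQ T A`. -/
theorem prob_Q_inter_eq_sum (rule : StoppingRule E) (p : E → R) (ends : E → Sym2 V) (a₁ a₂ : V)
    (A : Set (Config E)) :
    prob p (avoidAll ends a₂ {a₁} ∩ A) = ∑ T ∈ rule.records, T.mass p * condQ p ends a₁ a₂ T A :=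
  rule.prob_eq_sum_records p _

/-- **The given-`T` BHK part** (BHK06 Thm 1.3 at the pinned law, cluster of `a₂` avoiding `a₁`):
`P_{p_T}(Q, b ∈ C₂) · P_{p_T}(Q, o ∈ C₂) ≤ P_{p_T}(Q, b ∈ C₂, o ∈ C₂) · P_{p_T}(Q)`, i.e.
`Cov(1[b ∈ C₂], 1[o ∈ C₂] ∣ T, Q) ≥ 0` for EVERY record `T` — no contraction needed. -/
theorem cov_given_T_nonneg (p : E → R) (hp : IsProbVec p) (ends : E → Sym2 V) (o a₁ a₂ b : V)
    (T : Record E) :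
    condQ p ends a₁ a₂ T (connEvent ends a₂ b) * condQ p ends a₁ a₂ T (connEvent ends a₂ o) ≤
      condQ p ends a₁ a₂ T (connEvent ends a₂ b ∩ connEvent ends a₂ o) * condQ p ends a₁ a₂ T Set.univ := by
  have h := bhk_same_cluster_events_avoid (T.weights p) (isProbVec_weights T hp) ends a₂ {a₁}
    (show IsUpperSet {W : Set V | b ∈ W} from fun _ _ h hb => h hb)
    (show IsUpperSet {W : Set V | o ∈ W} from fun _ _ h ho => h ho)
  rw [← connEvent_eq_clusterInEvent ends a₂ b, ← connEvent_eq_clusterInEvent ends a₂ o,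
    ← BHKMixed.clusterInEvent_inter, ← connEvent_eq_clusterInEvent ends a₂ b,
    ← connEvent_eq_clusterInEvent ends a₂ o] at h
  unfold condQ
  rw [Set.inter_univ, Set.inter_comm (avoidAll ends a₂ {a₁}) (connEvent ends a₂ b),
    Set.inter_comm (avoidAll ends a₂ {a₁}) (connEvent ends a₂ o),
    Set.inter_comm (avoidAll ends a₂ {a₁}) (connEvent ends a₂ b ∩ connEvent ends a₂ o)]
  exact h

end GivenT

end Explore

end Summit.Ventures.PercRepro2
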